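import Summits.ResolutionOfSingularities.ResolutionOfSingularities.Theorems.HilbertSamuelEliminationSigmaMaxModificationsCorridor3RegularValue
import HarnessLib

/-!
# [OURS · L1 W4.2] THE DEGENERATE VALUE `ν = Φ^{(N)}`, part 2: reductions BY NAME for the row functionals
# (crux `SigmaMaxModifications` stmt-ResolutionOfSingularities-18506; conjunct `SigmaMaxModificationsCorridor3` stmt-…-19249;
# line `w_ladder` v6; plan-1 RULINGS v3.9-1 (R3))

Stub worker res-L1-w42-stub-1 (gen 3). Helper file `--supports stmt-ResolutionOfSingularities-19249 --as helper`; kernel only, no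
named fact, no new definition. Companion of `…Corridor3RegularValue` ((Φ-a) `IsMaximalOrigin.noNearChainFrom_of_eq_iterPSum`,
(Φ-b) `IsMaximalOrigin.not_isBlownUp_of_eq_iterPSum`): for each row functional of the line — `Moving.MaxOriginNoMovingNearChainAtQ`,
`Moving.MaxOriginNoMovingNearChainAt`, `Moving.MaxOriginNoMovingRecurrentNearChainAtQ`, `Helpers.ClosedOriginNoNearChainAtQ`,
`Helpers.ClosedOriginNoNearChainAt`, and W-mono `Helpers.ClosedOriginGeomDirDimNonincrease` — «to prove the row it suffices to prove
it for `ν ≠ Φ^{(N)}`» (the regular value is free), resp. «W-mono follows from `ē`-non-increase at GENUINE steps with `ν ≠ Φ^{(N)}`».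
OURS bookkeeping; NOT a statement of the manuscript [Hironaka2017] nor of [CossartJannsenSaito2020]. AI-written; AI review is weaker
than expert review.

## References
* V. Cossart, U. Jannsen, S. Saito, LNM 2270 (2020): Lemma 2.31, Rem. 6.29 (1), Thm. 3.10 (4). [CossartJannsenSaito2020]
-/

noncomputable section

set_option linter.dupNamespace false -- mandated namespace of this single-conjunct summit

open CategoryTheory AlgebraicGeometry TopologicalSpace Topology

namespace Summit.ResolutionOfSingularities.ResolutionOfSingularities.Theorems

namespace CampaignW42

open Literature.AlgebraicGeometry.Resolution Literature.RingTheory.HilbertSamuel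
open Summit.ResolutionOfSingularities.ResolutionOfSingularities.Theorems.SigmaMaxModificationsCorridor3

universe u

variable {p : ℕ} {R : ∀ S : Scheme.{u}, CentreSeq S → Prop} {N : ℕ} {ν : ℕ → ℕ}

/-! ## §6. Reductions BY NAME for the row functionals: it suffices to prove a row for `ν ≠ Φ^{(N)}` -/

/-- **`Moving.MaxOriginNoMovingNearChainAtQ`: the regular value is free** — to prove the row it suffices to treat `ν ≠ Φ^{(N)}`.
[folklore] -/
theorem _root_.Summit.ResolutionOfSingularities.ResolutionOfSingularities.Theorems.SigmaMaxModificationsCorridor3.Moving.maxOriginNoMovingNearChainAtQ_of_ne_iterPSum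
    {Q : ℕ → (ℕ → ℕ) → ∀ X : Scheme.{u}, X → Prop} {G : MarkedStage.{u} → Prop}
    (h : ∀ (R : ∀ S : Scheme.{u}, CentreSeq S → Prop), OracleFunctional R → OracleAdmissible R →
      ∀ (ν : ℕ → ℕ) (X : Scheme.{u}) [IsLocallyNoetherian X] (x : X), IsMaximalOrigin p N ν X x → Q N ν X x →
        ν ≠ iterPSum N Phi → NoMovingNearChainFrom R N ν (MarkedStage.init X x) G) :
    Moving.MaxOriginNoMovingNearChainAtQ p N Q G := by
  intro R hRf hRa ν X _ x hX hQ
  by_cases hν : ν = iterPSum N Phi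
  · exact hX.noMovingNearChainFrom_of_eq_iterPSum hRa hν G
  · exact h R hRf hRa ν X x hX hQ hν

/-- **`Moving.MaxOriginNoMovingNearChainAt`: the regular value is free.** [folklore] -/
theorem _root_.Summit.ResolutionOfSingularities.ResolutionOfSingularities.Theorems.SigmaMaxModificationsCorridor3.Moving.maxOriginNoMovingNearChainAt_of_ne_iterPSum
    {G : MarkedStage.{u} → Prop}
    (h : ∀ (R : ∀ S : Scheme.{u}, CentreSeq S → Prop), OracleFunctional R → OracleAdmissible R →
      ∀ (ν : ℕ → ℕ) (X : Scheme.{u}) [IsLocallyNoetherian X] (x : X), IsMaximalOrigin p N ν X x →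
        ν ≠ iterPSum N Phi → NoMovingNearChainFrom R N ν (MarkedStage.init X x) G) :
    Moving.MaxOriginNoMovingNearChainAt p N G := by
  intro R hRf hRa ν X _ x hX
  by_cases hν : ν = iterPSum N Phi
  · exact hX.noMovingNearChainFrom_of_eq_iterPSum hRa hν G
  · exact h R hRf hRa ν X x hX hν

/-- **`Moving.MaxOriginNoMovingRecurrentNearChainAtQ`: the regular value is free.** [folklore] -/
theorem _root_.Summit.ResolutionOfSingularities.ResolutionOfSingularities.Theorems.SigmaMaxModificationsCorridor3.Moving.maxOriginNoMovingRecurrentNearChainAtQ_of_ne_iterPSum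
    {Q : ℕ → (ℕ → ℕ) → ∀ X : Scheme.{u}, X → Prop} {G B : MarkedStage.{u} → Prop}
    (h : ∀ (R : ∀ S : Scheme.{u}, CentreSeq S → Prop), OracleFunctional R → OracleAdmissible R →
      ∀ (ν : ℕ → ℕ) (X : Scheme.{u}) [IsLocallyNoetherian X] (x : X), IsMaximalOrigin p N ν X x → Q N ν X x →
        ν ≠ iterPSum N Phi → Moving.NoMovingRecurrentNearChainFrom R N ν (MarkedStage.init X x) G B) :
    Moving.MaxOriginNoMovingRecurrentNearChainAtQ p N Q G B := by
  intro R hRf hRa ν X _ x hX hQ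
  by_cases hν : ν = iterPSum N Phi
  · rintro ⟨c, h0, hstep, hG, -, -⟩
    exact hX.noNearChainFrom_of_eq_iterPSum hRa hν G ⟨c, h0, hstep, hG⟩
  · exact h R hRf hRa ν X x hX hQ hν

/-- **`Helpers.ClosedOriginNoNearChainAtQ` (non-moving rows): the regular value is free.** [folklore] -/
theorem _root_.Summit.ResolutionOfSingularities.ResolutionOfSingularities.Theorems.SigmaMaxModificationsCorridor3.Helpers.closedOriginNoNearChainAtQ_of_ne_iterPSum
    {Q : ℕ → (ℕ → ℕ) → ∀ X : Scheme.{u}, X → Prop} {G : MarkedStage.{u} → Prop}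
    (h : ∀ (R : ∀ S : Scheme.{u}, CentreSeq S → Prop), OracleFunctional R → OracleAdmissible R →
      ∀ (ν : ℕ → ℕ) (X : Scheme.{u}) [IsLocallyNoetherian X] (x : X), IsMaximalOrigin p N ν X x → Q N ν X x →
        ν ≠ iterPSum N Phi → NoNearChainFrom R N ν (MarkedStage.init X x) G) :
    Helpers.ClosedOriginNoNearChainAtQ p N Q G := by
  intro R hRf hRa ν X _ x hX hQ
  by_cases hν : ν = iterPSum N Phi
  · exact hX.noNearChainFrom_of_eq_iterPSum hRa hν G
  · exact h R hRf hRa ν X x hX hQ hν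

/-- **`Helpers.ClosedOriginNoNearChainAt`: the regular value is free.** [folklore] -/
theorem _root_.Summit.ResolutionOfSingularities.ResolutionOfSingularities.Theorems.SigmaMaxModificationsCorridor3.Helpers.closedOriginNoNearChainAt_of_ne_iterPSum
    {G : MarkedStage.{u} → Prop}
    (h : ∀ (R : ∀ S : Scheme.{u}, CentreSeq S → Prop), OracleFunctional R → OracleAdmissible R →
      ∀ (ν : ℕ → ℕ) (X : Scheme.{u}) [IsLocallyNoetherian X] (x : X), IsMaximalOrigin p N ν X x →
        ν ≠ iterPSum N Phi → NoNearChainFrom R N ν (MarkedStage.init X x) G) :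
    Helpers.ClosedOriginNoNearChainAt p N G := by
  intro R hRf hRa ν X _ x hX
  by_cases hν : ν = iterPSum N Phi
  · exact hX.noNearChainFrom_of_eq_iterPSum hRa hν G
  · exact h R hRf hRa ν X x hX hν

/-- **W-MONO REDUCED TO GENUINE STEPS AT `ν ≠ Φ^{(N)}`**: `Helpers.ClosedOriginGeomDirDimNonincrease p N` follows from «`ē` does not
increase along every GENUINE canonical near step from a stage reached from a maximal origin with `ν ≠ Φ^{(N)}`» — waiting steps keep
the local ring (stub-2/this seat: `ē` equal), and at the regular value no genuine step has a successor (Φ-b). The genuine case at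
`ν ≠ Φ^{(N)}` is CJS Thm. 3.10 (4) (`CossartJannsenSaito2020_thm_3_10_4`, lead-1). [cite: CossartJannsenSaito2020, Thm. 3.10 (4)] -/
theorem _root_.Summit.ResolutionOfSingularities.ResolutionOfSingularities.Theorems.SigmaMaxModificationsCorridor3.Helpers.closedOriginGeomDirDimNonincrease_of_genuine_of_ne
    (hgen : ∀ (R : ∀ S : Scheme.{u}, CentreSeq S → Prop), OracleFunctional R → OracleAdmissible R →
      ∀ (ν : ℕ → ℕ) (X : Scheme.{u}) [IsLocallyNoetherian X] (x : X), IsMaximalOrigin p N ν X x → ν ≠ iterPSum N Phi →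
      ∀ (s s' : MarkedStage.{u}), Reaches R N ν (MarkedStage.init X x) s → CanonicalNearStep R N ν s s' →
        s.IsBlownUp R N ν → s'.geomDirDim ≤ s.geomDirDim) :
    Helpers.ClosedOriginGeomDirDimNonincrease.{u} p N := by
  intro R hRf hRa ν s s' hs h
  obtain ⟨X, hX, x, horig, hreach⟩ := hs
  by_cases hb : s.IsBlownUp R N ν
  · have hν : ν ≠ iterPSum N Phi := fun hν => horig.not_isBlownUp_of_eq_iterPSum hRf hRa hν hreach h hb
    exact hgen R hRf hRa ν X x horig hν s s' hreach h hb
  · -- waiting step: the local ring, hence `ē`, does not change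
    obtain ⟨C, P', hln, x', hst, hπ, -, -, rfl⟩ := h
    have hnot : s.pt ∉ (C.support : Set s.W) := fun hmem => hb ⟨C, P', hst, hmem⟩
    haveI := s.ln
    haveI := (blowup.isBlowup C).isIso_compl
    have hx'U : (blowup.π C).base x' ∈ (⟨(C.support : Set s.W)ᶜ, C.support.isClosed.isOpen_compl⟩ : s.W.Opens) := by
      show (blowup.π C).base x' ∈ (C.support : Set s.W)ᶜ
      rw [hπ]; exact hnot
    have heq := Scheme.geomDirDim_eq_of_isIso_morphismRestrict (blowup.π C)
      ⟨(C.support : Set s.W)ᶜ, C.support.isClosed.isOpen_compl⟩ x' hx'U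
    show Scheme.geomDirDim (blowup C) x' ≤ @Scheme.geomDirDim s.W s.ln s.pt
    rw [heq, hπ]

end CampaignW42

end Summit.ResolutionOfSingularities.ResolutionOfSingularities.Theorems

end
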